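import Literature.NumberTheory.EllipticCurves.IwasawaDualLayerCoinvariantsProofs
import Summits.BirchSwinnertonDyer.Rank1Residual.X11b.AnticyclotomicDualPair
import Summits.BirchSwinnertonDyer.BirchSwinnertonDyer.Theorems.CumulativeHeegnerLeopoldtCumulativeHeegnerInclusionAtThreeLayerControlCurve
import Summits.BirchSwinnertonDyer.BirchSwinnertonDyer.Theorems.CumulativeHeegnerLeopoldtCumulativeHeegnerInclusionAtThreeLayerTowerControl
import HarnessLib

/-!
# Crux K1 `CumulativeHeegnerInclusionAtThree` (stmt-BirchSwinnertonDyer-24198) — the port [P-ctl], Λ-side: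
# `X_ac^Σ ⧸ ω_m X_ac^Σ ≅ Hom(Sel_𝔭^Σ(K_∞, E[p^∞])^{γ^{p^m} = 1}, ℚ/ℤ)` at EVERY layer `m`, and the
# perfect-control instance of the module-level layer door

Width seat bsd-line-chl-k1-p1-w7 g0 (`--supports stmt-BirchSwinnertonDyer-24198`). THEOREMS ONLY (no definition,
no named fact, no `sorry`); ROUTE-INDEPENDENT (no `Theses` import). Nothing here proves the crux K1, its research
stub A (`TemperedHeegnerInclusionAtThree`, stmt-26896) or any summit statement; BSD is not proved by any of this.

## Why this file (lane [P-ctl] (c), dedupe line of 16:26Z: -w8 holds the Galois side, parts I/II)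

The layer-tower door (LT) for A (`…LayerTower`, p637184) is fed by the module-level door
`…LayerTowerControl.forall_pow_mul_mem_map_fittingIdeal_sup_layer` (p637962), whose LAYER DATA at layer `m`
are an exact `C_m → Y ⧸ ω_m Y → N_m → 0` over `Λ = ℤ_p⟦T⟧` (`ω_m = (1+T)^{p^m} − 1`, `Y = X_ac^Σ(E[p^∞])`,
`N_m` the layer-`m` Selmer dual). The Galois side of these data is Mazur's control along the layers —
`s_m : Sel_𝔭^Σ(K_m, E[p^∞]) → Sel_𝔭^Σ(K_∞, E[p^∞])^{γ^{p^m} = 1}` (-w8's `…LayerControl`, landed, and its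
curve-level sequel). THIS file is the `Λ`-side, on the CONSTRUCTED module `XAc W p κ 𝔭 S γ`
(`AnticyclotomicSelmerDual`: `X_ac^Σ := Hom(Sel_𝔭^Σ(K_∞, E[p^∞]), ℚ/ℤ)`, `1 + T ↦ conj_γ`):

* §1 `one_add_X_pow_smul_apply`, `omega_smul_apply` — `(1+T)^k` acts on `X_ac^Σ` as precomposition by
  `(conj_γ)^k`, and `ω_m` as precomposition by `(conj_γ)^{p^m} − 1` (generic
  `IwasawaDual.IsDualPair.toDual_omega_smul` applied to `XAc.isDualPair`);
* §2 **`exists_addEquiv_quotient_omega_characterModule`** — `X_ac^Σ ⧸ ω_m X_ac^Σ ≃ Hom(Sel_𝔭^Σ(K_∞, E[p^∞])^{(conj_γ)^{p^m} = 1}, ℚ/ℤ)`,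
  where the invariants are EXACTLY the target `IwasawaDual.endInvariants ((conjSelmerAc γ)^{p^m} − 1)` of the
  layer control map `s_m`; counting form `natCard_quotient_omega_eq` (`#(X_ac^Σ ⧸ ω_m) = #Sel^{γ^{p^m}=1}`),
  `finite_quotient_omega_iff`; and TRANSPORT along any control isomorphism
  `e : N ≃+ Sel^{γ^{p^m}=1}` (`exists_addEquiv_quotient_omega_characterModule_of_addEquiv`,
  `natCard_quotient_omega_eq_of_addEquiv`): `X_ac^Σ ⧸ ω_m X_ac^Σ ≃ Hom(N, ℚ/ℤ)`, `#(X_ac^Σ ⧸ ω_m) = #N` — with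
  `N = Sel_𝔭^Σ(K_m, E[p^∞])` and `e` the perfect-control isomorphism this is
  "`X_ac^Σ ⧸ ω_m X_ac^Σ` is the Pontryagin dual of `Sel_𝔭^Σ(K_m, E[p^∞])`";
* §2b the COMPOSITE with the Galois side (-w8's `…LayerControl` / `…LayerControlCurve`, imported):
  `exists_addEquiv_selmerOver_layer_of_control` (their output format "`res` injective ∧ every
  `conj_{γ^{pⁿ}}`-fixed class lifts" ⟹ `s_n : Sel_𝔭^Σ(K_n, E[p^∞]) ≃+ Sel^{(conj_γ)^{pⁿ} = 1}`),
  **`exists_addEquiv_quotient_omega_characterModule_selmerOver_layer`** (`X_ac^Σ ⧸ ω_n X_ac^Σ ≃ Hom(Sel_𝔭^Σ(K_n, E[p^∞]), ℚ/ℤ)`,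
  `Ψ(x̄)(c) = x(res c)`), `natCard_quotient_omega_eq_natCard_selmerOver_layer`, and the UNCONDITIONAL-IN-`n` tower
  count **`natCard_quotient_omega_eq_natCard_selmerOver_layer_of_bad_subset`**: for totally complex `K`,
  `E(K_∞)[p^∞] = 0`, `E(K̄)[p^∞]^{D_𝔭 ⊓ ker κ} = 0` and `Σ ⊇ {bad v ∤ p}`, `#(X_ac^Σ ⧸ ω_n X_ac^Σ) = #Sel_𝔭^Σ(K_n, E[p^∞])`
  for EVERY `n` (their `layerControl_of_bad_subset` read through §2);
* §3 **`forall_pow_mul_mem_map_fittingIdeal_sup_layer_of_perfectControl`** — the PERFECT-CONTROL instance of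
  the module-level door: when control is perfect one takes `N_m := Y ⧸ ω_m Y`, `C_m := 0`, and the door's
  exponent is the reciprocity exponent `μ` alone (no loss `a·g` from control): layer elements
  `θ_m ∈ Fitt₀(Y ⧸ ω_m Y)·R₀⟦T⟧` with `p^μ L ∈ (θ_m) + (p^m) + (ω_m)` for all `m` give hypothesis (LT) with
  exponent `μ`. Pure algebra over any finite `Λ`-module `Y`, any prime `p`.

What is NOT claimed: the Galois-side hypotheses of control (`E(K_∞)[p^∞] = 0`, no fixed points above the strict
place, AWAY descent at the BAD finitely decomposed `v ∤ p` when `v ∉ Σ` — -w8's files; Greenberg's Lemma 3.3 at bad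
`v` is not in the tree), the `Λ`-module structure of `Hom(Sel_𝔭^Σ(K_m, E[p^∞]), ℚ/ℤ)` and the `Λ`-linearity of the
composite (only additive isomorphisms and counts are recorded), any Kolyvagin system, reciprocity or
`L`-function.

References: [GreenbergLNM1716] §1 pp. 60–62, §3 p. 85; [Washington1997] §13.2, §13.4; [MazurTate1987] §1;
[Castella2018] §2.1–2.2 (arXiv:1704.06608 p. 5); [StacksProject] Tag 07ZA.
-/

noncomputable section

open scoped Classical

open NumberField IsDedekindDomain Field
open Literature.NumberTheory.EllipticCurves Literature.NumberTheory.EllipticCurves.GreenbergSelmer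
open Literature.NumberTheory.EllipticCurves.IwasawaDual Literature.NumberTheory.EllipticCurves.PontryaginCard
open Summit.BirchSwinnertonDyer.Rank1Residual.X11b Summit.BirchSwinnertonDyer.Rank1Residual.X11b.AcSelmer

-- every declaration of this file lives in the doubled summit namespace `Summit.BirchSwinnertonDyer.BirchSwinnertonDyer…`
set_option linter.dupNamespace false

namespace Summit.BirchSwinnertonDyer.BirchSwinnertonDyer.Theorems.CumulativeHeegnerInclusionAtThreeLayerDual

/-- Transport of a character-group isomorphism along `e : B ≃ A` (precomposition; private plumbing).
[folklore] -/
private theorem exists_addEquiv_characterModule_comp {M A B : Type*} [AddCommGroup M] [AddCommGroup A]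
    [AddCommGroup B] (Ψ : M ≃+ CharacterModule A) (e : B ≃+ A) :
    ∃ Ψ' : M ≃+ CharacterModule B, ∀ (m : M) (b : B), Ψ' m b = Ψ m (e b) := by
  let Φ : CharacterModule A ≃+ CharacterModule B :=
    AddEquiv.mk' (e.symm.addMonoidHomCongrLeftEquiv (N := AddCircle (1 : ℚ)))
      (fun χ χ' ↦ CharacterModule.ext (A := B) fun b ↦ rfl)
  exact ⟨Ψ.trans Φ, fun m b ↦ rfl⟩

/-! ## §1 `(1+T)^k` and `ω_m` on `X_ac^Σ(E[p^∞])` -/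

section XAc

variable {K : Type} [Field K] [NumberField K] (W : WeierstrassCurve K) (p : ℕ) [Fact p.Prime]
  (κ : ZpExtension K p) (𝔭 : HeightOneSpectrum (𝓞 K)) (S : Set (HeightOneSpectrum (𝓞 K)))
  (γ : absoluteGaloisGroup K) [Fact (κ.IsTopGenerator γ)]

/-- **`(1 + T)^k` acts on `X_ac^Σ(E[p^∞])` as precomposition by `(conj_γ)^k`**:
`((1+T)^k · x)(s) = x((conj_γ|_{Sel})^k s)` (`1 + T ↦ γ`, Cas18 §2.2).
[cite: Castella2018, §2.2 (arXiv:1704.06608 p. 5), "`1 + T ↦ γ`"] [cite: GreenbergLNM1716, §1 p. 62] -/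
theorem one_add_X_pow_smul_apply (k : ℕ) (x : XAc W p κ 𝔭 S γ) (s : selmerAc W p κ 𝔭 S) :
    (((1 + PowerSeries.X : IwasawaAlgebra p) ^ k) • x) s = x (((conjSelmerAc W p κ 𝔭 S γ) ^ k) s) :=
  (XAc.isDualPair W p κ 𝔭 S γ).toDual_one_add_X_pow_smul k x s

omit [Fact (κ.IsTopGenerator γ)] in
/-- The same with `(conj_γ)^k` unfolded to `conj_{γ^k}` on `H¹(K_∞, E[p^∞])`. [folklore] -/
theorem coe_conjSelmerAc_pow (k : ℕ) (s : selmerAc W p κ 𝔭 S) :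
    ((((conjSelmerAc W p κ 𝔭 S γ) ^ k) s : selmerAc W p κ 𝔭 S) : W.subgroupH1 p κ.kerSubgroup) =
      W.conjH1 p κ.kerSubgroup (γ ^ k) s :=
  coe_conjSelmerAc_pow_apply W p κ 𝔭 S γ k s

/-- **The layer polynomial `ω_m = (1 + T)^{p^m} − 1` acts on `X_ac^Σ(E[p^∞])` as precomposition by
`(conj_γ)^{p^m} − 1`**: `(ω_m · x)(s) = x((conj_γ)^{p^m} s) − x(s)`. So `ω_m X_ac^Σ` consists of the
characters vanishing on the `γ^{p^m}`-invariants, and `X_ac^Σ ⧸ ω_m X_ac^Σ` is their character group (§2).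
[cite: GreenbergLNM1716, §1 p. 62 (`θ_n = (1+T)^{pⁿ} − 1`)] [cite: Washington1997, §13.2] -/
theorem omega_smul_apply (m : ℕ) (x : XAc W p κ 𝔭 S γ) (s : selmerAc W p κ 𝔭 S) :
    ((((1 + PowerSeries.X : IwasawaAlgebra p) ^ (p ^ m) - 1)) • x) s =
      x (((conjSelmerAc W p κ 𝔭 S γ) ^ (p ^ m)) s) - x s := by
  have h : ((((1 + PowerSeries.X : IwasawaAlgebra p) ^ (p ^ m) - 1)) • x) s =
      x (((conjSelmerAc W p κ 𝔭 S γ) ^ (p ^ m) - 1) s) :=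
    (XAc.isDualPair W p κ 𝔭 S γ).toDual_omega_smul m x s
  rw [h, End_sub_apply, AddMonoid.End.one_apply, map_sub]

/-! ## §2 `X_ac^Σ ⧸ ω_m X_ac^Σ` is the character group of the `γ^{p^m}`-invariants -/

/-- **Pontryagin duality at layer `m` for `X_ac^Σ(E[p^∞])`:
`X_ac^Σ ⧸ ω_m X_ac^Σ ≃ Hom(Sel_𝔭^Σ(K_∞, E[p^∞])^{(conj_γ)^{p^m} = 1}, ℚ/ℤ)`**, by restriction of characters,
for every elliptic curve `E/K` over a number field, every prime `p`, every `ℤ_p`-extension `κ` with topological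
generator `γ`, every `𝔭`, `Σ`, `m`. The invariants `IwasawaDual.endInvariants ((conjSelmerAc γ)^{p^m} − 1)` are
BY NAME the target of the layer-`m` control map `s_m : Sel_𝔭^Σ(K_m, E[p^∞]) → Sel_𝔭^Σ(K_∞, E[p^∞])^{γ^{p^m} = 1}`
(`…LayerControl`). The case `m = 0` (`ω_0 = T`) is `XAc.natCard_coinvariants_eq`'s isomorphism.
[cite: GreenbergLNM1716, §1 p. 62 and §3 p. 85] [cite: Castella2018, §2.1 (arXiv:1704.06608 p. 5)] -/
theorem exists_addEquiv_quotient_omega_characterModule (m : ℕ) :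
    ∃ Ψ : (XAc W p κ 𝔭 S γ ⧸ (Ideal.span {((1 + PowerSeries.X : IwasawaAlgebra p) ^ (p ^ m) - 1)} • ⊤ :
        Submodule (IwasawaAlgebra p) (XAc W p κ 𝔭 S γ))) ≃+
          CharacterModule ↥(endInvariants ((conjSelmerAc W p κ 𝔭 S γ) ^ (p ^ m) - 1)),
      ∀ (x : XAc W p κ 𝔭 S γ) (a : endInvariants ((conjSelmerAc W p κ 𝔭 S γ) ^ (p ^ m) - 1)),
        Ψ (Submodule.Quotient.mk x) a = x a := by
  obtain ⟨Ψ, hΨ⟩ := (XAc.isDualPair W p κ 𝔭 S γ).exists_layerCoinvariants_addEquiv m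
  exact ⟨Ψ, fun x a ↦ hΨ x a⟩

/-- **`#(X_ac^Σ ⧸ ω_m X_ac^Σ) = #Sel_𝔭^Σ(K_∞, E[p^∞])^{(conj_γ)^{p^m} = 1}`** (`Nat.card`; both `0` when infinite).
[cite: GreenbergLNM1716, §1 p. 62 and §3 p. 85] -/
theorem natCard_quotient_omega_eq (m : ℕ) :
    Nat.card (XAc W p κ 𝔭 S γ ⧸ (Ideal.span {((1 + PowerSeries.X : IwasawaAlgebra p) ^ (p ^ m) - 1)} • ⊤ :
        Submodule (IwasawaAlgebra p) (XAc W p κ 𝔭 S γ))) =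
      Nat.card ↥(endInvariants ((conjSelmerAc W p κ 𝔭 S γ) ^ (p ^ m) - 1)) :=
  (XAc.isDualPair W p κ 𝔭 S γ).natCard_layerCoinvariants m

/-- `X_ac^Σ ⧸ ω_m X_ac^Σ` is finite iff `Sel_𝔭^Σ(K_∞, E[p^∞])^{(conj_γ)^{p^m} = 1}` is.
[cite: GreenbergLNM1716, §1 p. 62 and §3 p. 85] -/
theorem finite_quotient_omega_iff (m : ℕ) :
    Finite (XAc W p κ 𝔭 S γ ⧸ (Ideal.span {((1 + PowerSeries.X : IwasawaAlgebra p) ^ (p ^ m) - 1)} • ⊤ :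
        Submodule (IwasawaAlgebra p) (XAc W p κ 𝔭 S γ))) ↔
      Finite ↥(endInvariants ((conjSelmerAc W p κ 𝔭 S γ) ^ (p ^ m) - 1)) :=
  (XAc.isDualPair W p κ 𝔭 S γ).finite_layerCoinvariants_iff m

/-- **Transport along a control isomorphism.** For ANY additive isomorphism
`e : N ≃ Sel_𝔭^Σ(K_∞, E[p^∞])^{(conj_γ)^{p^m} = 1}` (intended: `N = Sel_𝔭^Σ(K_m, E[p^∞])` and `e` the layer-`m`
control isomorphism `s_m` of `…LayerControl`'s sequel, under perfect control), `X_ac^Σ ⧸ ω_m X_ac^Σ ≃ Hom(N, ℚ/ℤ)`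
with `Ψ(x̄)(n) = x(e n)`: "`X_ac^Σ ⧸ ω_m X_ac^Σ` is the Pontryagin dual of the layer-`m` Selmer group".
[cite: GreenbergLNM1716, §3 p. 85 (`s_n`) and §1 p. 62] [cite: MazurTate1987, §1] -/
theorem exists_addEquiv_quotient_omega_characterModule_of_addEquiv (m : ℕ) {N : Type*} [AddCommGroup N]
    (e : N ≃+ ↥(endInvariants ((conjSelmerAc W p κ 𝔭 S γ) ^ (p ^ m) - 1))) :
    ∃ Ψ : (XAc W p κ 𝔭 S γ ⧸ (Ideal.span {((1 + PowerSeries.X : IwasawaAlgebra p) ^ (p ^ m) - 1)} • ⊤ :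
        Submodule (IwasawaAlgebra p) (XAc W p κ 𝔭 S γ))) ≃+ CharacterModule N,
      ∀ (x : XAc W p κ 𝔭 S γ) (n : N), Ψ (Submodule.Quotient.mk x) n = x (e n) := by
  obtain ⟨Ψ, hΨ⟩ := exists_addEquiv_quotient_omega_characterModule W p κ 𝔭 S γ m
  obtain ⟨Ψ', hΨ'⟩ := exists_addEquiv_characterModule_comp Ψ e
  exact ⟨Ψ', fun x n ↦ by rw [hΨ', hΨ]⟩

/-- **`#(X_ac^Σ ⧸ ω_m X_ac^Σ) = #N` for any `N ≃ Sel_𝔭^Σ(K_∞, E[p^∞])^{(conj_γ)^{p^m} = 1}`** — with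
`N = Sel_𝔭^Σ(K_m, E[p^∞])` under perfect control: the order of the layer-`m` coinvariants of `X_ac^Σ` is the order
of the layer-`m` Selmer group (`Nat.card`; both `0` when infinite). [cite: GreenbergLNM1716, §3 p. 85 and §1 p. 62] -/
theorem natCard_quotient_omega_eq_of_addEquiv (m : ℕ) {N : Type*} [AddCommGroup N]
    (e : N ≃+ ↥(endInvariants ((conjSelmerAc W p κ 𝔭 S γ) ^ (p ^ m) - 1))) :
    Nat.card (XAc W p κ 𝔭 S γ ⧸ (Ideal.span {((1 + PowerSeries.X : IwasawaAlgebra p) ^ (p ^ m) - 1)} • ⊤ :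
        Submodule (IwasawaAlgebra p) (XAc W p κ 𝔭 S γ))) = Nat.card N := by
  rw [natCard_quotient_omega_eq, Nat.card_congr e.toEquiv]

end XAc

/-! ## §2b Composite with the Galois side (`…LayerControl`, `…LayerControlCurve`):
`X_ac^Σ ⧸ ω_n X_ac^Σ` is the Pontryagin dual of `Sel_𝔭^Σ(K_n, E[p^∞])` under layer control -/

section Composite

open Summit.BirchSwinnertonDyer.BirchSwinnertonDyer.Theorems.CumulativeHeegnerInclusionAtThreeLayerControl
open Summit.BirchSwinnertonDyer.BirchSwinnertonDyer.Theorems.CumulativeHeegnerInclusionAtThreeLayerControlCurve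

variable {K : Type} [Field K] [NumberField K] {p : ℕ} [Fact p.Prime] (κ : ZpExtension K p)
  (W : WeierstrassCurve K) (𝔭 : HeightOneSpectrum (𝓞 K)) (S : Set (HeightOneSpectrum (𝓞 K)))
  (γ : absoluteGaloisGroup K)

/-- **Layer control, isomorphism form.** If the restriction `res_{K_n → K_∞}` is injective on
`H¹(K_n, E[p^∞])` and every `conj_{γ^{pⁿ}}`-fixed class of `Sel_𝔭^Σ(K_∞, E[p^∞])` lifts to `Sel_𝔭^Σ(K_n, E[p^∞])`
(the OUTPUT FORMAT of `…LayerControlCurve.layerControl_of_bad_descent` / `…_of_bad_subset`), then restriction is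
an additive ISOMORPHISM `s_n : Sel_𝔭^Σ(K_n, E[p^∞]) ≃ Sel_𝔭^Σ(K_∞, E[p^∞])^{(conj_γ)^{pⁿ} = 1}` onto
`IwasawaDual.endInvariants ((conjSelmerAc γ)^{pⁿ} − 1)` — the subgroup dual to `X_ac^Σ ⧸ ω_n X_ac^Σ` (§2).
[cite: GreenbergLNM1716, §3 p. 85 (`s_n`) and p. 90 (Thm. 1.2)] -/
theorem exists_addEquiv_selmerOver_layer_of_control (n : ℕ)
    (hinj : Function.Injective (W.resOfLe p (κ.kerSubgroup_le_layerSubgroup n)))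
    (hsurj : ∀ x ∈ selmerAc W p κ 𝔭 S, W.conjH1 p κ.kerSubgroup (γ ^ p ^ n) x = x →
        ∃ c ∈ selmerOver (κ.layerSubgroup n) (W.geomPrimaryTorsion p) p 𝔭 S,
          W.resOfLe p (κ.kerSubgroup_le_layerSubgroup n) c = x) :
    ∃ e : ↥(selmerOver (κ.layerSubgroup n) (W.geomPrimaryTorsion p) p 𝔭 S) ≃+
        ↥(endInvariants ((conjSelmerAc W p κ 𝔭 S γ) ^ (p ^ n) - 1)),
      ∀ c, (((e c : ↥(endInvariants ((conjSelmerAc W p κ 𝔭 S γ) ^ (p ^ n) - 1))) :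
          selmerAc W p κ 𝔭 S) : W.subgroupH1 p κ.kerSubgroup) =
        W.resOfLe p (κ.kerSubgroup_le_layerSubgroup n) c := by
  let s : ↥(selmerOver (κ.layerSubgroup n) (W.geomPrimaryTorsion p) p 𝔭 S) →+
      ↥(endInvariants ((conjSelmerAc W p κ 𝔭 S γ) ^ (p ^ n) - 1)) :=
    { toFun := fun c ↦ ⟨⟨W.resOfLe p (κ.kerSubgroup_le_layerSubgroup n) c,
          resOfLe_layer_mem_selmerOver κ n c.2⟩,
        resOfLe_layer_mem_endInvariants_pow' κ W 𝔭 S n γ c.2⟩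
      map_zero' := Subtype.ext (Subtype.ext (by simp))
      map_add' := fun a b ↦ Subtype.ext (Subtype.ext (by simp)) }
  have hs : ∀ c, (((s c : ↥(endInvariants ((conjSelmerAc W p κ 𝔭 S γ) ^ (p ^ n) - 1))) :
      selmerAc W p κ 𝔭 S) : W.subgroupH1 p κ.kerSubgroup) =
        W.resOfLe p (κ.kerSubgroup_le_layerSubgroup n) c := fun _ ↦ rfl
  have hsinj : Function.Injective s := by
    rw [injective_iff_map_eq_zero]
    intro c hc
    have hc' : W.resOfLe p (κ.kerSubgroup_le_layerSubgroup n) c = 0 := by rw [← hs c, hc]; rfl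
    exact Subtype.ext ((injective_iff_map_eq_zero _).mp hinj _ hc')
  have hssurj : Function.Surjective s := by
    intro x
    have hx := (mem_endInvariants_iff _ (x : selmerAc W p κ 𝔭 S)).mp x.2
    rw [End_sub_apply, AddMonoid.End.one_apply, sub_eq_zero] at hx
    have hx' : W.conjH1 p κ.kerSubgroup (γ ^ p ^ n)
        ((x : selmerAc W p κ 𝔭 S) : W.subgroupH1 p κ.kerSubgroup) = (x : selmerAc W p κ 𝔭 S) := by
      rw [← coe_conjSelmerAc_pow_apply]
      exact congrArg (fun y : selmerAc W p κ 𝔭 S ↦ (y : W.subgroupH1 p κ.kerSubgroup)) hx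
    obtain ⟨c, hc, hcx⟩ := hsurj _ (x : selmerAc W p κ 𝔭 S).2 hx'
    exact ⟨⟨c, hc⟩, Subtype.ext (Subtype.ext (by rw [hs]; exact hcx))⟩
  exact ⟨AddEquiv.ofBijective s ⟨hsinj, hssurj⟩, hs⟩

variable [Fact (κ.IsTopGenerator γ)]

/-- **`X_ac^Σ ⧸ ω_n X_ac^Σ ≃ Hom(Sel_𝔭^Σ(K_n, E[p^∞]), ℚ/ℤ)` under layer control** (control in the format of
`…LayerControlCurve`: `res` injective and every `conj_{γ^{pⁿ}}`-fixed class lifts): `Ψ(x̄)(c) = x(res c)`.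
This is the identification "`N_n = X ⧸ ω_n X` is the layer-`n` Selmer dual" that the layer-tower door consumes
(with `C_n = 0`, §3). [cite: GreenbergLNM1716, §3 p. 85 and §1 p. 62] [cite: MazurTate1987, §1] -/
theorem exists_addEquiv_quotient_omega_characterModule_selmerOver_layer (n : ℕ)
    (hinj : Function.Injective (W.resOfLe p (κ.kerSubgroup_le_layerSubgroup n)))
    (hsurj : ∀ x ∈ selmerAc W p κ 𝔭 S, W.conjH1 p κ.kerSubgroup (γ ^ p ^ n) x = x →
        ∃ c ∈ selmerOver (κ.layerSubgroup n) (W.geomPrimaryTorsion p) p 𝔭 S,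
          W.resOfLe p (κ.kerSubgroup_le_layerSubgroup n) c = x) :
    ∃ Ψ : (XAc W p κ 𝔭 S γ ⧸ (Ideal.span {((1 + PowerSeries.X : IwasawaAlgebra p) ^ (p ^ n) - 1)} • ⊤ :
        Submodule (IwasawaAlgebra p) (XAc W p κ 𝔭 S γ))) ≃+
          CharacterModule ↥(selmerOver (κ.layerSubgroup n) (W.geomPrimaryTorsion p) p 𝔭 S),
      ∀ (x : XAc W p κ 𝔭 S γ) (c : ↥(selmerOver (κ.layerSubgroup n) (W.geomPrimaryTorsion p) p 𝔭 S)),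
        Ψ (Submodule.Quotient.mk x) c =
          x ⟨W.resOfLe p (κ.kerSubgroup_le_layerSubgroup n) c, resOfLe_layer_mem_selmerOver κ n c.2⟩ := by
  obtain ⟨e, he⟩ := exists_addEquiv_selmerOver_layer_of_control κ W 𝔭 S γ n hinj hsurj
  obtain ⟨Ψ, hΨ⟩ := exists_addEquiv_quotient_omega_characterModule_of_addEquiv W p κ 𝔭 S γ n e
  refine ⟨Ψ, fun x c ↦ ?_⟩
  rw [hΨ]
  congr 1
  exact Subtype.ext (he c)

/-- **`#(X_ac^Σ ⧸ ω_n X_ac^Σ) = #Sel_𝔭^Σ(K_n, E[p^∞])` under layer control** (`Nat.card`; both `0` when infinite).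
[cite: GreenbergLNM1716, §3 p. 90 (Thm. 1.2) and §1 p. 62] -/
theorem natCard_quotient_omega_eq_natCard_selmerOver_layer (n : ℕ)
    (hinj : Function.Injective (W.resOfLe p (κ.kerSubgroup_le_layerSubgroup n)))
    (hsurj : ∀ x ∈ selmerAc W p κ 𝔭 S, W.conjH1 p κ.kerSubgroup (γ ^ p ^ n) x = x →
        ∃ c ∈ selmerOver (κ.layerSubgroup n) (W.geomPrimaryTorsion p) p 𝔭 S,
          W.resOfLe p (κ.kerSubgroup_le_layerSubgroup n) c = x) :
    Nat.card (XAc W p κ 𝔭 S γ ⧸ (Ideal.span {((1 + PowerSeries.X : IwasawaAlgebra p) ^ (p ^ n) - 1)} • ⊤ :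
        Submodule (IwasawaAlgebra p) (XAc W p κ 𝔭 S γ))) =
      Nat.card ↥(selmerOver (κ.layerSubgroup n) (W.geomPrimaryTorsion p) p 𝔭 S) := by
  obtain ⟨e, -⟩ := exists_addEquiv_selmerOver_layer_of_control κ W 𝔭 S γ n hinj hsurj
  exact natCard_quotient_omega_eq_of_addEquiv W p κ 𝔭 S γ n e

/-- **The tower, unconditionally in `n`, for totally complex `K` and `Σ ⊇ {bad v ∤ p}`**: if `E(K_∞)[p^∞] = 0`,
`E(K̄)[p^∞]^{D_𝔭 ⊓ ker κ} = 0` and `Σ` contains every finite place `v ∤ p` of bad reduction, then for EVERY `n`,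
`#(X_ac^Σ ⧸ ω_n X_ac^Σ) = #Sel_𝔭^Σ(K_n, E[p^∞])` — `…LayerControlCurve.layerControl_of_bad_subset` (exact control
along the whole tower, Greenberg Lemmas 3.1–3.3 on the tree's objects) read through §2. For `Σ = ∅` use
`natCard_quotient_omega_eq_natCard_selmerOver_layer` with `layerControl_of_bad_descent` (descent at the bad
finitely decomposed `v` as hypothesis). [cite: GreenbergLNM1716, §3 Lemmas 3.1–3.3 and p. 90 (Thm. 1.2)] -/
theorem natCard_quotient_omega_eq_natCard_selmerOver_layer_of_bad_subset [IsTotallyComplex K] [W.IsElliptic]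
    (hγ : κ.IsTopGenerator γ)
    (hB : FixedPoints.addSubgroup κ.kerSubgroup (W.geomPrimaryTorsion p) = ⊥)
    (h0 : FixedPoints.addSubgroup ↥(decomp 𝔭 ⊓ κ.kerSubgroup) (W.geomPrimaryTorsion p) = ⊥)
    (hbad : ∀ v : HeightOneSpectrum (𝓞 K), (p : 𝓞 K) ∉ v.asIdeal → ¬ W.HasGoodReductionAt v → v ∈ S)
    (n : ℕ) :
    Nat.card (XAc W p κ 𝔭 S γ ⧸ (Ideal.span {((1 + PowerSeries.X : IwasawaAlgebra p) ^ (p ^ n) - 1)} • ⊤ :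
        Submodule (IwasawaAlgebra p) (XAc W p κ 𝔭 S γ))) =
      Nat.card ↥(selmerOver (κ.layerSubgroup n) (W.geomPrimaryTorsion p) p 𝔭 S) := by
  obtain ⟨hinj, hlift⟩ := layerControl_of_bad_subset κ W 𝔭 S n hγ hB h0 hbad
  exact natCard_quotient_omega_eq_natCard_selmerOver_layer κ W 𝔭 S γ n hinj fun x hx hfix ↦ by
    obtain ⟨c, ⟨hc, hcx⟩, -⟩ := hlift x hx hfix
    exact ⟨c, hc, hcx⟩

end Composite

/-! ## §3 The perfect-control instance of the module-level layer door -/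

section Door

open Literature.RingTheory.FittingIdeal
open Summit.BirchSwinnertonDyer.BirchSwinnertonDyer.Theorems.CumulativeHeegnerInclusionAtThreeLayerTowerControl

universe v

variable {p : ℕ} [Fact p.Prime] {Y : Type v} [AddCommGroup Y] [Module (IwasawaAlgebra p) Y]
  [Module.Finite (IwasawaAlgebra p) Y]

/-- **The module-level layer door under PERFECT control: no exponent is lost to control.** Over
`Λ = ℤ_p⟦T⟧ → R₀⟦T⟧` (`toUnr`, any prime `p`), for a finite `Λ`-module `Y` (intended `X_ac^Σ = X_{∅,0}(𝔭′)`),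
take as layer data `N_m := Y ⧸ ω_m Y` ITSELF and `C_m := 0` — which is what perfect control
`Y ⧸ ω_m Y ≅ Hom(Sel_𝔭^Σ(K_m, E[p^∞]), ℚ/ℤ)` (§2 with `…LayerControl`) licenses. Then layer elements
`θ_m ∈ Fitt₀(Y ⧸ ω_m Y)·R₀⟦T⟧` and layer congruences `p^μ · L ∈ (θ_m) + (p^m) + (ω_m)` at every `m` give, for every
`m`, `p^μ · L ∈ Fitt₀(Y)·R₀⟦T⟧ + (p^m) + (ω_m)` — hypothesis (LT) of
`…LayerTower.temperedHeegnerInclusionAtThree_of_fittingLayerTower` with exponent EXACTLY `μ` (the door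
`…LayerTowerControl.forall_pow_mul_mem_map_fittingIdeal_sup_layer` with `a = g = 0`). Pure algebra; nothing about
the existence of the `θ_m` is asserted. [cite: MazurTate1987, §1] [cite: StacksProject, Tag 07ZA] -/
theorem forall_pow_mul_mem_map_fittingIdeal_sup_layer_of_perfectControl (μ : ℕ) (θ : ℕ → UnrSeries p)
    {L : UnrSeries p}
    (hθ : ∀ m, θ m ∈ (Module.fittingIdeal (IwasawaAlgebra p)
      (Y ⧸ (Ideal.span {((1 + PowerSeries.X) ^ (p ^ m) - 1 : IwasawaAlgebra p)} •
        (⊤ : Submodule (IwasawaAlgebra p) Y))) 0).map (PowerSeries.map (Halves.toUnr p)))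
    (hrec : ∀ m, ((p : ℕ) : UnrSeries p) ^ μ * L ∈ Ideal.span {θ m} ⊔
      Ideal.span {((p : ℕ) : UnrSeries p) ^ m} ⊔
        Ideal.span {((1 + PowerSeries.X) ^ (p ^ m) - 1 : UnrSeries p)}) (m : ℕ) :
    ((p : ℕ) : UnrSeries p) ^ μ * L ∈
      (Module.fittingIdeal (IwasawaAlgebra p) Y 0).map (PowerSeries.map (Halves.toUnr p)) ⊔
        Ideal.span {((p : ℕ) : UnrSeries p) ^ m} ⊔
          Ideal.span {((1 + PowerSeries.X) ^ (p ^ m) - 1 : UnrSeries p)} := by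
  have h := @forall_pow_mul_mem_map_fittingIdeal_sup_layer p _ Y _ _ _ 0 0 μ (fun _ ↦ PUnit.{v + 1}) _ _
    (fun m ↦ Y ⧸ (Ideal.span {((1 + PowerSeries.X) ^ (p ^ m) - 1 : IwasawaAlgebra p)} •
      (⊤ : Submodule (IwasawaAlgebra p) Y))) _ _ _
    (fun _ ↦ 0) (fun _ ↦ LinearMap.id)
    (fun m y ↦ ⟨fun hy ↦ ⟨PUnit.unit, by rw [LinearMap.zero_apply]; exact (hy : y = 0).symm⟩,
      fun ⟨u, hu⟩ ↦ by rw [← hu, LinearMap.zero_apply]; rfl⟩)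
    (fun _ y ↦ ⟨y, rfl⟩)
    (fun _ ↦ ⟨Fin.elim0, eq_top_iff.mpr fun u _ ↦ by rw [Subsingleton.elim u 0]; exact zero_mem _⟩)
    (fun _ ↦ Module.mem_annihilator.mpr fun u ↦ Subsingleton.elim _ _) θ L hθ hrec m
  rwa [zero_mul, zero_add] at h

end Door


end Summit.BirchSwinnertonDyer.BirchSwinnertonDyer.Theorems.CumulativeHeegnerInclusionAtThreeLayerDual

end
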